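import Literature.AlgebraicGeometry.AbelianSchemes.PoincareSheafMulN
import Literature.AlgebraicGeometry.AbelianSchemes.AbelianSchemeOverLevelBaseChange
import Literature.AlgebraicGeometry.AbelianSchemes.AbelianSchemeOverRestrictPt
import Literature.AlgebraicGeometry.Motives.AbelianVarietyTranslation
import Literature.AlgebraicGeometry.Modules.EquivariantStructure
import HarnessLib

/-!
# The translation action of the `M`-torsion sections over `[M]`, its base change, and its fibres
# ([MumfordAV1970] §7 Thm. 4 / §20: `X_n` acts on `X` over `n_X`; [GortzWedhorn2023] Def. 27.1)

Layer `Literature/AlgebraicGeometry/AbelianSchemes`, namespace `Literature.AlgebraicGeometry.AbelianSchemes.AbelianSchemeOver`.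
DEFINITIONS WITH BODIES AND THEOREMS ONLY (no named fact, no instance, no notation, no `sorry`).

For an abelian scheme `A/S` and `M : ℕ` the `M`-torsion sections `A[M](S) ⊆ A(S)` (`torsionSections`) act by translations on
the total space of EVERY base change `A_T = A ×_S T` (`f : T ⟶ S`), and these translations commute with `[M]_{A_T}`
([MumfordAV1970] §7 Thm. 4 p. 72: `t_σ ≫ [M] = [M]` for `σ^M = e`, ★ `translation_comp_mulN`): this is the VARIABLE action
`ρ : ActionOver ((A.baseChange f).mulN M).left K` that ★ `TorsionSectionPairing` (W1b), ★ `TorsionSectionPairingBaseChange`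
(W1c) and ★ `FibreWeilPairingDiscrepancy` (W3a) take as input, constructed ONCE:

* §1 `torsionSections A M : Subgroup A.Sections` (`σ ^ M = 1`);
* §2 **`translation_sectionBaseChange`** — base change of a translation is the translation by the base-changed section:
  `(A.baseChange f).translation (σ ×_S T) = (A.translation σ) ×_S T` (Mathlib: `Over.pullback f` is monoidal); the action
  `translationActionOfHom A M χ hχ : ActionOver (A.mulN M).left K` of any `χ : K →* A(S)` with `M`-torsion values, its instances
  **`translationActionMulN A M : ActionOver (A.mulN M).left (A.torsionSections M)`** (`σ ↦ t_σ`) and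
  **`torsionTranslationAction A M f : ActionOver ((A.baseChange f).mulN M).left (A.torsionSections M)`** (`σ ↦ t_{σ ×_S T}`);
* §3 the comparison square along `t : T′ ⟶ T`: `baseChangeRestrict A f t : A_{T′} ⟶ A_T` (`= 𝟙_A ×_S t`) with
  `baseChangeRestrict_comp_hom` (over `t`), `baseChangeRestrict_comp_map_left` (natural in `S`-endomorphisms of `A`),
  `baseChangeRestrict_comp_mulN_left` (commutes with `[M]`), `autHom_comp_baseChangeRestrict` (intertwines the actions) — the
  hypotheses `ht / hsq / hι` of ★ `TorsionPairing.pairingUnit_baseChange`;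
* §4 at a geometric point `s : Spec Ω ⟶ S`: `sectionPt s τ` (the `Ω`-point of a section `τ` of `A_s → Spec Ω`;
  `sectionPt_sectionBaseChange : sectionPt s (σ ×_S Spec Ω) = restrictPt s σ`), **`translation_sectionPt_eq`** /
  **`autHom_torsionTranslationAction_eq_translation_restrictPt`** — the action of `σ` on `A_s` IS the translation `t_{σ(s)}` of the
  fibre abelian variety by the point `σ(s)`, the hypothesis `hg` of ★ `weilPairingLevel_eq_inv_of_poincare_discrepancy`; and
  `restrictPt_mem_torsionPoints`, `restrictTorsionPt`.

Cell hodgecm-mathlib (D-0151), F-DAG (h9) symplectic half, (W3-core) FILE 1 (census `B-provers/B-p13/g18/CENSUS-h9S-W3-Assembly`;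
B-plan1 (g15) 05:06:30Z; B-p03 (g16) FIT 05:20:30Z). Count-neutral capital; HC_CM is proved only modulo the 7 printed citations
until rung 0 closes — nothing here is about HC.

## References
* [MumfordAV1970] D. Mumford, *Abelian Varieties* (1970), §7 Thm. 4 (p. 72), §20 (pp. 183–185).
* [GortzWedhorn2023] U. Görtz, T. Wedhorn, *Algebraic Geometry II* (2023), Def./Rem. 27.1 (p. 604) (translations).
* [GortzWedhorn2020] U. Görtz, T. Wedhorn, *Algebraic Geometry I*, 2nd ed. (2020), Section (4.7), (4.7.1) (p. 108) (base
  change functor, transitivity).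
* [MumfordFogartyKirwan1994] D. Mumford, J. Fogarty, F. Kirwan, *GIT*, 3rd ed., Ch. 7 §2 Def. 7.1 (p. 129) (sections on fibres).
-/

set_option autoImplicit false

noncomputable section

-- `Over`-morphism components and the transported group structures are compared across `def`s (as in the tree's W1 files).
set_option backward.isDefEq.respectTransparency false

universe u

open CategoryTheory CategoryTheory.Limits AlgebraicGeometry MonoidalCategory CartesianMonoidalCategory
open scoped MonObj

namespace Literature.AlgebraicGeometry.AbelianSchemes.AbelianSchemeOver

open Literature.AlgebraicGeometry.RelativeSpec Literature.AlgebraicGeometry.Motives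
  Literature.AlgebraicGeometry.AbelianVarieties

variable {S : Scheme.{u}} (A : AbelianSchemeOver S) [IsCommMonObj A.X] (M : ℕ)

/-! ## §1 The `M`-torsion sections `A[M](S)` -/

/-- **The subgroup `A[M](S) ⊆ A(S)` of `M`-torsion sections** (`σ ^ M = 1` in the commutative group of sections).
[cite: MumfordFogartyKirwan1994, Ch. 7 §2 Definition 7.1 (p. 129)] -/
def torsionSections : Subgroup A.Sections := (powMonoidHom M : A.Sections →* A.Sections).ker

/-- Membership in `A[M](S)`: `σ ^ M = 1`. [cite: MumfordFogartyKirwan1994, Ch. 7 §2 Definition 7.1 (p. 129)] -/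
theorem mem_torsionSections_iff (σ : A.Sections) : σ ∈ A.torsionSections M ↔ σ ^ M = 1 := Iff.rfl

/-- An element of `A[M](S)` is `M`-torsion. [cite: MumfordFogartyKirwan1994, Ch. 7 §2 Definition 7.1 (p. 129)] -/
theorem torsionSections_pow (σ : A.torsionSections M) : (σ : A.Sections) ^ M = 1 := σ.2

/-- Base change preserves `M`-torsion: `(σ ×_S T) ^ M = 1`. [cite: MumfordFogartyKirwan1994, Ch. 7 §2 Definition 7.2 (p. 129)] -/
theorem sectionBaseChange_pow_eq_one {T : Scheme.{u}} (f : T ⟶ S) (σ : A.torsionSections M) :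
    A.sectionBaseChange f (σ : A.Sections) ^ M = 1 := by
  rw [← map_pow, A.torsionSections_pow M σ, map_one]

/-! ## §2 Base change of translations; the translation action over `[M]_{A_T}` -/

omit [IsCommMonObj A.X] in
/-- **Base change of a translation is the translation by the base-changed section**: `t_{σ ×_S T} = t_σ ×_S T` as
endomorphisms of `A_T = A ×_S T` (`Over.pullback f` is cartesian monoidal: `(c · 𝟙) ×_S T = (c ×_S T) · 𝟙`, and the constant
map at `σ` pulls back to the constant map at `σ ×_S T`). [cite: GortzWedhorn2020, Section (4.7), (4.7.1) (p. 108)]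
[cite: GortzWedhorn2023, Def. 27.1 (p. 604)] -/
theorem translation_sectionBaseChange {T : Scheme.{u}} (f : T ⟶ S) (σ : A.Sections) :
    (A.baseChange f).translation (A.sectionBaseChange f σ) = baseChangeHom (A.translation σ) f := by
  have key : toUnit ((A.baseChange f).X) ≫ Functor.LaxMonoidal.ε (Over.pullback f) =
      (Over.pullback f).map (toUnit A.X) := by
    rw [← cancel_mono (Functor.Monoidal.εIso (Over.pullback f)).inv]
    exact toUnit_unique _ _
  have key2 : toUnit ((A.baseChange f).X) ≫ A.sectionBaseChange f σ = (Over.pullback f).map (toUnit A.X ≫ σ) := by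
    rw [sectionBaseChange_apply, ← Category.assoc, key, Functor.map_comp]
  unfold translation
  rw [key2, baseChangeHom, Functor.map_mul, CategoryTheory.Functor.map_id]
  rfl

/-- **The translation action OVER `[M]_A` of a group `K` mapped to `M`-torsion sections** (`χ : K →* A(S)`, `χ(k)^M = 1`):
`k ↦ t_{χ k}` as automorphisms of the total space, over `[M]` because `t_σ ≫ [M] = [M]` for `σ^M = 1` ([MumfordAV1970] §7
Thm. 4; ★ `translation_comp_mulN`) — the one construction behind `translationActionMulN` (`χ` = the inclusion of `A[M](S)`),
`torsionTranslationAction` (`χ` = base change of sections) and the point actions of the sequel.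
[cite: MumfordAV1970, §7 Thm. 4 (p. 72)] [cite: MumfordAV1970, §20 (p. 184)] -/
def translationActionOfHom {K : Type u} [Group K] (χ : K →* A.Sections) (hχ : ∀ k, χ k ^ M = 1) :
    ActionOver (A.mulN M).left K where
  aut := ((Over.forget S).mapAut A.X).comp (A.translationAut.comp χ)
  aut_comp k := by
    change (A.translation (χ k)).left ≫ _ = _
    rw [← Over.comp_left, A.translation_comp_mulN _ M (hχ k)]

/-- `k` acts by (the underlying scheme morphism of) `t_{χ k}`. [cite: MumfordAV1970, §7 Thm. 4 (p. 72)] -/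
theorem translationActionOfHom_autHom {K : Type u} [Group K] (χ : K →* A.Sections) (hχ : ∀ k, χ k ^ M = 1) (k : K) :
    (A.translationActionOfHom M χ hχ).autHom k = (A.translation (χ k)).left := rfl

/-- **The translation action of `A[M](S)` on `A` OVER `[M]_A`** (`σ ↦ t_σ`; [MumfordAV1970] §20: «the action of
translation by points of `X_n` on … `n_X`»). [cite: MumfordAV1970, §20 (p. 184)] -/
def translationActionMulN : ActionOver (A.mulN M).left (A.torsionSections M) :=
  A.translationActionOfHom M (A.torsionSections M).subtype (A.torsionSections_pow M)

/-- `σ ∈ A[M](S)` acts by `t_σ`. [cite: MumfordAV1970, §20 (p. 184)] -/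
theorem translationActionMulN_autHom (σ : A.torsionSections M) :
    (A.translationActionMulN M).autHom σ = (A.translation (σ : A.Sections)).left := rfl

variable {T : Scheme.{u}} (f : T ⟶ S) [IsCommMonObj (A.baseChange f).X]

/-- **The translation action of `A[M](S)` on `A_T` OVER `[M]_{A_T}`**: `σ ↦ t_{σ ×_S T}` (an automorphism of the total space of
`A ×_S T`), and `t_{σ ×_S T} ≫ [M] = [M]` because `σ ×_S T` is `M`-torsion ([MumfordAV1970] §7 Thm. 4: the translations by
`X_n` act over `n_X`; ★ `translation_comp_mulN`). For a geometric point `f = s` this is the action on the fibre (§4).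
[cite: MumfordAV1970, §7 Thm. 4 (p. 72)] [cite: MumfordAV1970, §20 (p. 184)] -/
def torsionTranslationAction : ActionOver ((A.baseChange f).mulN M).left (A.torsionSections M) :=
  (A.baseChange f).translationActionOfHom M ((A.sectionBaseChange f).comp (A.torsionSections M).subtype)
    (A.sectionBaseChange_pow_eq_one M f)

/-- `σ` acts by (the underlying scheme morphism of) `t_{σ ×_S T}`. [cite: MumfordAV1970, §7 Thm. 4 (p. 72)] -/
theorem torsionTranslationAction_autHom (σ : A.torsionSections M) :
    (A.torsionTranslationAction M f).autHom σ =
      ((A.baseChange f).translation (A.sectionBaseChange f (σ : A.Sections))).left := rfl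

/-- `σ` acts by `(t_σ ×_S T)` — the base change of the translation of `A`. [cite: GortzWedhorn2020, Section (4.7), (4.7.1) (p. 108)] -/
theorem torsionTranslationAction_autHom_eq_baseChangeHom_left (σ : A.torsionSections M) :
    (A.torsionTranslationAction M f).autHom σ = (baseChangeHom (A.translation (σ : A.Sections)) f).left := by
  rw [torsionTranslationAction_autHom, translation_sectionBaseChange]

/-! ## §3 The comparison square along `t : T′ ⟶ T` -/

section Restrict

omit [IsCommMonObj A.X] [IsCommMonObj (A.baseChange f).X]

variable {T' : Scheme.{u}} (t : T' ⟶ T)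

/-- **`A_{T′} → A_T` over `t : T′ → T`** (`= 𝟙_A ×_S t : A ×_S T′ → A ×_S T`), for `A_{T′} := A.baseChange (t ≫ f)`.
[cite: GortzWedhorn2020, Section (4.7), (4.7.1) (p. 108)] -/
def baseChangeRestrict : (A.baseChange (t ≫ f)).X.left ⟶ (A.baseChange f).X.left :=
  pullback.lift (pullback.fst A.X.hom (t ≫ f)) (pullback.snd A.X.hom (t ≫ f) ≫ t)
    ((pullback.condition (f := A.X.hom) (g := t ≫ f)).trans (Category.assoc _ _ _).symm)

/-- `(A_{T′} → A_T) ≫ pr_A = pr_A`. [cite: GortzWedhorn2020, Section (4.7), (4.7.1) (p. 108)] -/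
@[reassoc (attr := simp)]
theorem baseChangeRestrict_comp_fst :
    A.baseChangeRestrict f t ≫ pullback.fst A.X.hom f = pullback.fst A.X.hom (t ≫ f) := by
  rw [baseChangeRestrict, pullback.lift_fst]

/-- `(A_{T′} → A_T) ≫ pr_T = pr_{T′} ≫ t`. [cite: GortzWedhorn2020, Section (4.7), (4.7.1) (p. 108)] -/
@[reassoc (attr := simp)]
theorem baseChangeRestrict_comp_snd :
    A.baseChangeRestrict f t ≫ pullback.snd A.X.hom f = pullback.snd A.X.hom (t ≫ f) ≫ t := by
  rw [baseChangeRestrict, pullback.lift_snd]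

/-- **`(A_{T′} → A_T)` lies over `t`**: `q ≫ π_T = π_{T′} ≫ t` — the hypothesis `ht` of ★ `pairingUnit_baseChange`.
[cite: GortzWedhorn2020, Section (4.7), (4.7.1) (p. 108)] -/
@[reassoc]
theorem baseChangeRestrict_comp_hom :
    A.baseChangeRestrict f t ≫ (A.baseChange f).X.hom = (A.baseChange (t ≫ f)).X.hom ≫ t :=
  A.baseChangeRestrict_comp_snd f t

/-- **Naturality in `S`-endomorphisms of `A`**: `q ≫ (v ×_S T) = (v ×_S T′) ≫ q`. [cite: GortzWedhorn2020, Section (4.7), (4.7.1) (p. 108)] -/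
@[reassoc]
theorem baseChangeRestrict_comp_map_left (v : A.X ⟶ A.X) :
    A.baseChangeRestrict f t ≫ (baseChangeHom v f).left = (baseChangeHom v (t ≫ f)).left ≫ A.baseChangeRestrict f t := by
  refine pullback.hom_ext ?_ ?_
  · simp only [Category.assoc, baseChangeHom, Over.pullback_map_left, pullback.lift_fst, baseChangeRestrict_comp_fst_assoc,
      baseChangeRestrict_comp_fst]
  · simp only [Category.assoc, baseChangeHom, Over.pullback_map_left, pullback.lift_snd, baseChangeRestrict_comp_snd,
      pullback.lift_snd_assoc]

/-- **`q` commutes with `[M]`**: `q ≫ [M]_{A_T} = [M]_{A_{T′}} ≫ q` (both are base changes of `[M]_A`, ★ `baseChangeHom_mulN`) —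
the hypothesis `hsq` of ★ `pairingUnit_baseChange`. [cite: GortzWedhorn2020, Section (4.7), (4.7.1) (p. 108)] -/
@[reassoc]
theorem baseChangeRestrict_comp_mulN_left :
    A.baseChangeRestrict f t ≫ ((A.baseChange f).mulN M).left = ((A.baseChange (t ≫ f)).mulN M).left ≫ A.baseChangeRestrict f t := by
  rw [← baseChangeHom_mulN A f M, ← baseChangeHom_mulN A (t ≫ f) M, baseChangeRestrict_comp_map_left]

end Restrict

/-- **`q` intertwines the translation actions**: `ρ_{T′}(σ) ≫ q = q ≫ ρ_T(σ)` (both translations are base changes of `t_σ`) — the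
hypothesis `hι` of ★ `pairingUnit_baseChange`. [cite: MumfordAV1970, §7 Thm. 4 (p. 72)] [cite: GortzWedhorn2020, Section (4.7), (4.7.1) (p. 108)] -/
@[reassoc]
theorem autHom_comp_baseChangeRestrict {T' : Scheme.{u}} (t : T' ⟶ T) [IsCommMonObj (A.baseChange (t ≫ f)).X]
    (σ : A.torsionSections M) :
    (A.torsionTranslationAction M (t ≫ f)).autHom σ ≫ A.baseChangeRestrict f t =
      A.baseChangeRestrict f t ≫ (A.torsionTranslationAction M f).autHom σ := by
  rw [torsionTranslationAction_autHom_eq_baseChangeHom_left, torsionTranslationAction_autHom_eq_baseChangeHom_left,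
    baseChangeRestrict_comp_map_left]

/-! ## §4 At a geometric point: the action is the translation of the fibre by the point `σ(s)` -/

section Point

variable {Ω : Type u} [Field Ω] (s : Spec (.of Ω) ⟶ S) [IsCommMonObj (A.baseChange s).X]

omit [IsCommMonObj A.X] [IsCommMonObj (A.baseChange s).X] in
/-- **The `Ω`-point of the fibre `A_s` underlying a section of `A_s → Spec Ω`**: `Spec Ω → 𝟙_{Spec Ω} → A_s` (pre-composition
with the canonical `Ω`-isomorphism `specOver Ω Ω ⟶ 𝟙_`; ★ `restrictPt s σ` is `sectionPt s (σ ×_S Spec Ω)`,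
`sectionPt_sectionBaseChange`). [cite: MumfordFogartyKirwan1994, Ch. 7 §2 Definition 7.1 (p. 129)] -/
def sectionPt (τ : (A.baseChange s).Sections) : (A.fibre s).toAbelianVariety.Points Ω :=
  toUnit (specOver Ω Ω) ≫ τ

omit [IsCommMonObj A.X] [IsCommMonObj (A.baseChange s).X] in
/-- `sectionPt` unfolded. [cite: MumfordFogartyKirwan1994, Ch. 7 §2 Definition 7.1 (p. 129)] -/
theorem sectionPt_def (τ : (A.baseChange s).Sections) : A.sectionPt s τ = toUnit (specOver Ω Ω) ≫ τ := rfl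

omit [IsCommMonObj A.X] [IsCommMonObj (A.baseChange s).X] in
/-- **`σ(s)` is the point of the section `σ ×_S Spec Ω`** (★ `restrictPt_eq_toUnit_comp_map`).
[cite: MumfordFogartyKirwan1994, Ch. 7 §2 Definition 7.1 (p. 129) and Definition 7.3 (p. 129)] -/
theorem sectionPt_sectionBaseChange (σ : A.Sections) : A.sectionPt s (A.sectionBaseChange s σ) = A.restrictPt s σ := by
  rw [sectionPt, sectionBaseChange_apply, restrictPt_eq_toUnit_comp_map]

omit [IsCommMonObj A.X] [IsCommMonObj (A.baseChange s).X] in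
/-- `sectionPt` is multiplicative (pre-composition, Mathlib `MonObj.comp_mul`). [cite: MumfordFogartyKirwan1994, Ch. 7 §2 Definition 7.1 (p. 129)] -/
theorem sectionPt_mul (τ τ' : (A.baseChange s).Sections) : A.sectionPt s (τ * τ') = A.sectionPt s τ * A.sectionPt s τ' :=
  MonObj.comp_mul _ _ _

omit [IsCommMonObj A.X] [IsCommMonObj (A.baseChange s).X] in
/-- `sectionPt 1 = 1`. [cite: MumfordFogartyKirwan1994, Ch. 7 §2 Definition 7.1 (p. 129)] -/
theorem sectionPt_one : A.sectionPt s (η[(A.baseChange s).X] : (A.baseChange s).Sections) = 1 := by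
  rw [sectionPt, MonObj.one_eq_one, MonObj.comp_one]

omit [IsCommMonObj A.X] [IsCommMonObj (A.baseChange s).X] in
/-- `sectionPt` commutes with powers. [cite: MumfordFogartyKirwan1994, Ch. 7 §2 Definition 7.1 (p. 129)] -/
theorem sectionPt_pow (τ : (A.baseChange s).Sections) (n : ℕ) : A.sectionPt s (τ ^ n) = A.sectionPt s τ ^ n :=
  MonObj.comp_pow _ _ _

omit [IsCommMonObj A.X] [IsCommMonObj (A.baseChange s).X] in
/-- The underlying morphism `Spec Ω ⟶ A ×_S Spec Ω` of `sectionPt τ` is that of `τ` (the canonical point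
`Spec Ω → 𝟙_{Spec Ω}` is `Spec` of `algebraMap Ω Ω = id`). [cite: MumfordFogartyKirwan1994, Ch. 7 §2 Definition 7.1 (p. 129)] -/
theorem sectionPt_left (τ : (A.baseChange s).Sections) :
    ((A.sectionPt s τ).left : Spec (.of Ω) ⟶ pullback A.X.hom s) = τ.left := by
  have ht : (toUnit (specOver Ω Ω)).left = 𝟙 (Spec (.of Ω)) := by
    change Spec.map (CommRingCat.ofHom (algebraMap Ω Ω)) = _
    rw [Algebra.algebraMap_self, CommRingCat.ofHom_id, Spec.map_id]
  change (toUnit (specOver Ω Ω)).left ≫ τ.left = τ.left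
  rw [ht]
  exact Category.id_comp _

omit [IsCommMonObj A.X] [IsCommMonObj (A.baseChange s).X] in
/-- The constant map of the `Ω`-scheme `A_s` at the point of `τ` IS the constant map at the section `τ` (maps to a terminal
object are unique). [cite: MumfordFogartyKirwan1994, Ch. 7 §2 Definition 7.1 (p. 129) and Definition 7.3 (p. 129)] -/
theorem toSpecOver_comp_sectionPt (τ : (A.baseChange s).Sections) :
    toSpecOver (A.fibre s).toAbelianVariety.X ≫ A.sectionPt s τ = toUnit (A.baseChange s).X ≫ τ := by
  rw [sectionPt, ← Category.assoc]
  congr 1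
  exact toUnit_unique (toSpecOver (A.fibre s).toAbelianVariety.X ≫ toUnit (specOver Ω Ω)) (toUnit (A.baseChange s).X)

omit [IsCommMonObj A.X] [IsCommMonObj (A.baseChange s).X] in
/-- **The translation of the fibre abelian variety `A_s` by the point of a section `τ` of `A_s → Spec Ω` is the translation of
the abelian scheme `A_s` by `τ`** (same group object; the two constant maps agree). [cite: GortzWedhorn2023, Def. 27.1 (p. 604)]
[cite: MumfordFogartyKirwan1994, Ch. 7 §2 Definition 7.1 (p. 129)] -/
theorem translation_sectionPt_eq (τ : (A.baseChange s).Sections) :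
    (A.fibre s).toAbelianVariety.translation (A.sectionPt s τ) = (A.baseChange s).translation τ := by
  unfold AbelianVariety.translation AbelianSchemeOver.translation
  rw [toSpecOver_comp_sectionPt]
  rfl

omit [IsCommMonObj A.X] in
/-- **A point action over `[M]_{A_s}` acts by translations of the fibre abelian variety**: for `χ : K →* A_s(Spec Ω)` with
`M`-torsion values, `k` acts by `t_{pt(χ k)}` — the hypothesis `hg` of ★ `weilPairingLevel_eq_inv_of_poincare_discrepancy`.
[cite: MumfordAV1970, §20 (p. 184)] [cite: GortzWedhorn2023, Def. 27.1 (p. 604)] -/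
theorem autHom_translationActionOfHom_eq_translation_sectionPt {K : Type u} [Group K]
    (χ : K →* (A.baseChange s).Sections) (hχ : ∀ k, χ k ^ M = 1) (k : K) :
    ((A.baseChange s).translationActionOfHom M χ hχ).autHom k =
      ((A.fibre s).toAbelianVariety.translation (A.sectionPt s (χ k))).left := by
  rw [translationActionOfHom_autHom, translation_sectionPt_eq]

omit [IsCommMonObj A.X] [IsCommMonObj (A.baseChange s).X] in
/-- The constant map of the `Ω`-scheme `A_s` at the point `σ(s)` IS the constant map at the section `σ ×_S Spec Ω`
(`σ(s) = (Spec Ω → 𝟙_s) ≫ (σ ×_S Spec Ω)`, ★ `restrictPt_eq_toUnit_comp_map`; maps to a terminal object are unique).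
[cite: MumfordFogartyKirwan1994, Ch. 7 §2 Definition 7.1 (p. 129) and Definition 7.3 (p. 129)] -/
theorem toSpecOver_comp_restrictPt (σ : A.Sections) :
    toSpecOver (A.fibre s).toAbelianVariety.X ≫ A.restrictPt s σ = toUnit (A.baseChange s).X ≫ A.sectionBaseChange s σ := by
  rw [← sectionPt_sectionBaseChange, toSpecOver_comp_sectionPt]

omit [IsCommMonObj A.X] [IsCommMonObj (A.baseChange s).X] in
/-- **The translation of the fibre abelian variety `A_s` by the point `σ(s)` is the translation of `A_s = A ×_S Spec Ω` by the
section `σ ×_S Spec Ω`**. [cite: GortzWedhorn2023, Def. 27.1 (p. 604)] [cite: MumfordFogartyKirwan1994, Ch. 7 §2 Definition 7.1 (p. 129)] -/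
theorem translation_restrictPt_eq (σ : A.Sections) :
    (A.fibre s).toAbelianVariety.translation (A.restrictPt s σ) = (A.baseChange s).translation (A.sectionBaseChange s σ) := by
  rw [← sectionPt_sectionBaseChange, translation_sectionPt_eq]

/-- **`σ` acts on the fibre `A_s` by the translation `t_{σ(s)}` of the fibre abelian variety** — the hypothesis `hg` of ★
`weilPairingLevel_eq_inv_of_poincare_discrepancy` for the action `torsionTranslationAction A M s`.
[cite: MumfordAV1970, §20 (p. 184)] [cite: GortzWedhorn2023, Def. 27.1 (p. 604)] -/
theorem autHom_torsionTranslationAction_eq_translation_restrictPt (σ : A.torsionSections M) :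
    (A.torsionTranslationAction M s).autHom σ =
      ((A.fibre s).toAbelianVariety.translation (A.restrictPt s (σ : A.Sections))).left := by
  rw [torsionTranslationAction_autHom, translation_restrictPt_eq]

omit [IsCommMonObj (A.baseChange s).X] in
/-- **`σ(s) ∈ A_s[M](Ω)` for `σ ∈ A[M](S)`** (★ `restrictPt_pow_eq_one`), in the `torsionPoints Ω (M : ℤ)` currency of ★
`weilPairingLevel`. [cite: MumfordFogartyKirwan1994, Ch. 7 §2 Definition 7.1 (p. 129)] -/
theorem restrictPt_mem_torsionPoints (σ : A.torsionSections M) :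
    A.restrictPt s (σ : A.Sections) ∈ (A.fibre s).toAbelianVariety.torsionPoints Ω (M : ℤ) := by
  refine (AbelianVariety.mem_torsionPoints_iff _ _).2 ?_
  rw [zpow_natCast]
  exact A.restrictPt_pow_eq_one s (A.torsionSections_pow M σ)

/-- The `M`-torsion point `σ(s) ∈ A_s[M](Ω)` of a torsion section (the point `restrictPt` bundled with
`restrictPt_mem_torsionPoints`). [cite: MumfordFogartyKirwan1994, Ch. 7 §2 Definition 7.1 (p. 129)] -/
def restrictTorsionPt (σ : A.torsionSections M) : (A.fibre s).toAbelianVariety.torsionPoints Ω (M : ℤ) :=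
  ⟨A.restrictPt s (σ : A.Sections), A.restrictPt_mem_torsionPoints M s σ⟩

omit [IsCommMonObj (A.baseChange s).X] in
/-- The underlying point of `restrictTorsionPt` (definitional). [cite: MumfordFogartyKirwan1994, Ch. 7 §2 Definition 7.1 (p. 129)] -/
@[simp]
theorem coe_restrictTorsionPt (σ : A.torsionSections M) :
    ((A.restrictTorsionPt M s σ : (A.fibre s).toAbelianVariety.torsionPoints Ω (M : ℤ)) :
      (A.fibre s).toAbelianVariety.Points Ω) = A.restrictPt s (σ : A.Sections) := rfl

omit [IsCommMonObj (A.baseChange s).X] in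
/-- `σ ↦ σ(s)` is multiplicative on `A[M](S) → A_s[M](Ω)` (★ `restrictPt_mul`). [cite: MumfordFogartyKirwan1994, Ch. 7 §2 Definition 7.1 (p. 129)] -/
theorem restrictTorsionPt_mul (σ τ : A.torsionSections M) :
    A.restrictTorsionPt M s (σ * τ) = A.restrictTorsionPt M s σ * A.restrictTorsionPt M s τ :=
  Subtype.ext (A.restrictPt_mul s σ τ)

omit [IsCommMonObj (A.baseChange s).X] in
/-- `1 ↦ 1`. [cite: MumfordFogartyKirwan1994, Ch. 7 §2 Definition 7.1 (p. 129)] -/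
theorem restrictTorsionPt_one : A.restrictTorsionPt M s 1 = 1 :=
  Subtype.ext (A.restrictPt_one s)

end Point

end Literature.AlgebraicGeometry.AbelianSchemes.AbelianSchemeOver

end
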